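import Mathlib
import Summits.Ventures.PercRepro2.Defs
import Summits.Ventures.PercRepro2.Graph
import Summits.Ventures.PercRepro2.OneColourSwitch
import Summits.Ventures.PercRepro2.RegionHubSign
import Summits.Ventures.PercRepro2.SideSwitch
import Summits.Ventures.PercRepro2.SideSwitchFibre
import Summits.Ventures.PercRepro2.SideSwitchComps
import Summits.Ventures.PercRepro2.TermSwitchDefs
import Summits.Ventures.PercRepro2.TermSwitchFibre
import Summits.Ventures.PercRepro2.TermSwitchMono
import Summits.Ventures.PercRepro2.TermSwitchM9
import Summits.Ventures.PercRepro2.TermSwitchRestrict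
import Summits.Ventures.PercRepro2.M9LoopTransfer
import Summits.Ventures.PercRepro2.M9NoPocketDefs
import Summits.Ventures.PercRepro2.M9SingleDPocket
import Summits.Ventures.PercRepro2.M9Trichotomy
import Summits.Ventures.PercRepro2.M9EdgeTransfer
import Summits.Ventures.PercRepro2.M9GammaEval
import Summits.Ventures.PercRepro2.M9GammaBase

/-!
# The doubly-reached sum is twice a restricted terminal-set sum of the looped graph, hence
non-positive (blind cell PercRepro2, p3 g24, 2026-08-28; `proofs/P3-CONJG.md` §4)

Reindexing the four `T`-colourings of a pair of edges `er = d–r`, `es = d–s` onto the colourings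
with both `Y` (`gammaSum_eq_four`) and summing the four doubly-reached terms pointwise
(`four_terms_eq`, `gamma_iff`, the worlds and `σ_pq` blind to the edges inside `{r, s, d}`) gives
`gammaSum = 2 · dzeroSignSumHP endsT (both `T`-edges `Y`)` (`gammaSum_eq_two_dzeroP`), which is
non-positive by the fibre-restricted terminal-set theorem (`gammaSum_nonpos`).  No hypothesis on
the other edges: parallel copies of the `T`-edges stay in the looped graph.  Own work; std axioms.
-/

namespace Summit.Ventures.PercRepro2

namespace NoPocket

open Finset Classical RegionHub OneColourSwitch SideSwitch TermSwitch

variable {V : Type*} {E : Type*}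

section Flip

variable [DecidableEq E]

/-- Flipping the colour of one edge is an involution of the colourings. -/
lemma flipEdge_involutive (e₀ : E) :
    Function.Involutive (fun ω : Config E => Function.update ω e₀ (!ω e₀)) := by
  intro ω
  funext e
  by_cases h : e = e₀
  · subst h; simp
  · simp [Function.update_of_ne h]

/-- The flip of one edge as a permutation of the colourings. -/
noncomputable def flipEdge (e₀ : E) : Equiv.Perm (Config E) :=
  Function.Involutive.toPerm _ (flipEdge_involutive e₀)

/-- `flipEdge` unfolded. -/
lemma flipEdge_apply (e₀ : E) (ω : Config E) : flipEdge e₀ ω = Function.update ω e₀ (!ω e₀) := rfl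

/-- Reindexing a sum over colourings by the flip of one edge. -/
lemma sum_flipEdge [Fintype E] (e₀ : E) (F : Config E → ℤ) :
    ∑ ω, F (flipEdge e₀ ω) = ∑ ω, F ω :=
  Equiv.sum_comp (flipEdge e₀) F

end Flip

section Reindex

variable [Fintype V] [DecidableEq V] [Fintype E] [DecidableEq E] {ends : E → Sym2 V}
  {p q r s d : V} {er es : E}

/-- The summand of `gammaSum`. -/
noncomputable def gTerm (ends : E → Sym2 V) (p q r s d : V) (ω : Config E) : ℤ :=
  if sep2 ends p q r s ω ∧ DOne ends r s d ω ∧ d ∈ K2 ends r s ω ∧ d ∈ M2 ends r s ω then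
    sigma ends ω p q * sigma ends ω r s else 0

omit [Fintype V] [DecidableEq V] in
/-- `gammaSum` is the sum of its summands. -/
lemma gammaSum_eq_sum_gTerm :
    gammaSum ends p q r s d = ∑ ω, gTerm ends p q r s d ω := rfl

omit [Fintype V] [DecidableEq V] [Fintype E] [DecidableEq E] in
/-- The summand through the terminal set: on `Sep_H ∧ DZero_H` it is `σ_pq · dTerm`. -/
lemma gTerm_eq_of_L {ω : Config E}
    (hL : sepH ends p q ({r, s, d} : Set V) ω ∧ DZeroH ends ({r, s, d} : Set V) ω) :
    gTerm ends p q r s d ω = sigma ends ω p q * dTerm ends r s d ω := by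
  unfold gTerm dTerm
  by_cases hKM : d ∈ K2 ends r s ω ∧ d ∈ M2 ends r s ω
  · have h : sep2 ends p q r s ω ∧ DOne ends r s d ω ∧ d ∈ K2 ends r s ω ∧
        d ∈ M2 ends r s ω := gamma_iff.2 ⟨hL.1, hL.2, hKM.1, hKM.2⟩
    rw [if_pos h, if_pos hKM]
  · have h : ¬ (sep2 ends p q r s ω ∧ DOne ends r s d ω ∧ d ∈ K2 ends r s ω ∧
        d ∈ M2 ends r s ω) := fun h => hKM ⟨h.2.2.1, h.2.2.2⟩
    rw [if_neg h, if_neg hKM, mul_zero]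

omit [Fintype V] [DecidableEq V] [Fintype E] [DecidableEq E] in
/-- The summand vanishes off `Sep_H ∧ DZero_H`. -/
lemma gTerm_eq_zero_of_not_L {ω : Config E}
    (hL : ¬ (sepH ends p q ({r, s, d} : Set V) ω ∧ DZeroH ends ({r, s, d} : Set V) ω)) :
    gTerm ends p q r s d ω = 0 := by
  unfold gTerm
  rw [if_neg]
  intro h
  exact hL ⟨(gamma_iff.1 h).1, (gamma_iff.1 h).2.1⟩

omit [Fintype V] [DecidableEq V] [Fintype E] in
/-- A `T`-flip of `ω` agrees with `ω` off `er, es`, so `Sep_H ∧ DZero_H` in `ends` at the flip is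
`Sep_H ∧ DZero_H` in the looped graph at `ω`. -/
lemma L_flip_iff (her : ends er = s(d, r)) (hes : ends es = s(d, s)) {ω ω' : Config E}
    (hω : ∀ e, e ≠ er → e ≠ es → ω e = ω' e) :
    (sepH ends p q ({r, s, d} : Set V) ω' ∧ DZeroH ends ({r, s, d} : Set V) ω') ↔
      (sepH (endsT ends d er es) p q ({r, s, d} : Set V) ω ∧
        DZeroH (endsT ends d er es) ({r, s, d} : Set V) ω) := by
  have hA := agreeOff_endsT her hes (ω := ω') (ω' := ω) hω
  rw [sepH_iff_of_agree_off hA (endsT_keeps_inside), DZeroH_iff_of_agree_off hA (endsT_keeps_inside)]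

omit [Fintype V] [DecidableEq V] in
/-- `σ_pq` at a `T`-flip is `σ_pq` of the looped graph. -/
lemma sigma_pq_flip (her : ends er = s(d, r)) (hes : ends es = s(d, s)) {ω ω' : Config E}
    (hω : ∀ e, e ≠ er → e ≠ es → ω e = ω' e) (hsep : sepH ends p q ({r, s, d} : Set V) ω') :
    sigma ends ω' p q = sigma (endsT ends d er es) ω p q :=
  sigma_pq_eq_of_agree_off (agreeOff_endsT her hes (ω := ω') (ω' := ω) hω)
    (endsT_keeps_inside) hsep

omit [Fintype V] [DecidableEq V] in
/-- **The four `T`-colourings of a `YY`-colouring sum to twice the looped summand.** -/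
lemma four_gTerms_eq (her : ends er = s(d, r)) (hes : ends es = s(d, s)) (hne : er ≠ es)
    {ω : Config E} (h1 : ω er = true) (h2 : ω es = true) :
    gTerm ends p q r s d ω + gTerm ends p q r s d (Function.update ω es false) +
      gTerm ends p q r s d (Function.update ω er false) +
      gTerm ends p q r s d (Function.update (Function.update ω er false) es false) =
      2 * (if sepH (endsT ends d er es) p q ({r, s, d} : Set V) ω ∧
          DZeroH (endsT ends d er es) ({r, s, d} : Set V) ω then
        sigma (endsT ends d er es) ω p q * sigma (endsT ends d er es) ω r s else 0) := by
  have hω1 : ∀ e, e ≠ er → e ≠ es → ω e = ω e := fun _ _ _ => rfl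
  have hω2 : ∀ e, e ≠ er → e ≠ es → ω e = Function.update ω es false e :=
    fun e _ h => by rw [Function.update_of_ne h]
  have hω3 : ∀ e, e ≠ er → e ≠ es → ω e = Function.update ω er false e :=
    fun e h _ => by rw [Function.update_of_ne h]
  have hω4 : ∀ e, e ≠ er → e ≠ es →
      ω e = Function.update (Function.update ω er false) es false e :=
    fun e h h' => by rw [Function.update_of_ne h', Function.update_of_ne h]
  by_cases hL : sepH (endsT ends d er es) p q ({r, s, d} : Set V) ω ∧
      DZeroH (endsT ends d er es) ({r, s, d} : Set V) ω
  · rw [if_pos hL]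
    have e1 := (L_flip_iff (p := p) (q := q) her hes hω1).2 hL
    have e2 := (L_flip_iff (p := p) (q := q) her hes hω2).2 hL
    have e3 := (L_flip_iff (p := p) (q := q) her hes hω3).2 hL
    have e4 := (L_flip_iff (p := p) (q := q) her hes hω4).2 hL
    rw [gTerm_eq_of_L e1, gTerm_eq_of_L e2, gTerm_eq_of_L e3, gTerm_eq_of_L e4,
      sigma_pq_flip her hes hω1 e1.1, sigma_pq_flip her hes hω2 e2.1,
      sigma_pq_flip her hes hω3 e3.1, sigma_pq_flip her hes hω4 e4.1,
      ← mul_add, ← mul_add, ← mul_add, four_terms_eq her hes hne h1 h2]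
    ring
  · rw [if_neg hL]
    rw [gTerm_eq_zero_of_not_L (fun h => hL ((L_flip_iff her hes hω1).1 h)),
      gTerm_eq_zero_of_not_L (fun h => hL ((L_flip_iff her hes hω2).1 h)),
      gTerm_eq_zero_of_not_L (fun h => hL ((L_flip_iff her hes hω3).1 h)),
      gTerm_eq_zero_of_not_L (fun h => hL ((L_flip_iff her hes hω4).1 h))]
    ring

omit [Fintype V] [DecidableEq V] in
/-- **Reindexing**: `gammaSum` is the sum over the `YY`-colourings of the four `T`-colourings. -/
lemma gammaSum_eq_four (hne : er ≠ es) :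
    gammaSum ends p q r s d = ∑ ω, if ω er = true ∧ ω es = true then
      gTerm ends p q r s d ω + gTerm ends p q r s d (Function.update ω es false) +
        gTerm ends p q r s d (Function.update ω er false) +
        gTerm ends p q r s d (Function.update (Function.update ω er false) es false) else 0 := by
  set G := gTerm ends p q r s d with hG
  -- split by the colours of `er, es`
  have hsplit : ∑ ω, G ω =
      (∑ ω, if ω er = true ∧ ω es = true then G ω else 0) +
      (∑ ω, if ω er = true ∧ ω es = false then G ω else 0) +
      (∑ ω, if ω er = false ∧ ω es = true then G ω else 0) +
      (∑ ω, if ω er = false ∧ ω es = false then G ω else 0) := by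
    rw [← Finset.sum_add_distrib, ← Finset.sum_add_distrib, ← Finset.sum_add_distrib]
    refine Finset.sum_congr rfl fun ω _ => ?_
    cases h1 : ω er <;> cases h2 : ω es <;> simp
  -- reindex the three flipped classes onto the `YY`-colourings
  have hYW : (∑ ω, if ω er = true ∧ ω es = false then G ω else 0) =
      ∑ ω, if ω er = true ∧ ω es = true then G (Function.update ω es false) else 0 := by
    rw [← sum_flipEdge es (fun ω => if ω er = true ∧ ω es = false then G ω else 0)]
    refine Finset.sum_congr rfl fun ω _ => ?_
    simp only [flipEdge_apply, Function.update_of_ne hne, Function.update_self]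
    cases h2 : ω es <;> simp
  have hWY : (∑ ω, if ω er = false ∧ ω es = true then G ω else 0) =
      ∑ ω, if ω er = true ∧ ω es = true then G (Function.update ω er false) else 0 := by
    rw [← sum_flipEdge er (fun ω => if ω er = false ∧ ω es = true then G ω else 0)]
    refine Finset.sum_congr rfl fun ω _ => ?_
    simp only [flipEdge_apply, Function.update_of_ne hne.symm, Function.update_self]
    cases h1 : ω er <;> simp
  have hWW : (∑ ω, if ω er = false ∧ ω es = false then G ω else 0) =
      ∑ ω, if ω er = true ∧ ω es = true then
        G (Function.update (Function.update ω er false) es false) else 0 := by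
    rw [← sum_flipEdge er (fun ω => if ω er = false ∧ ω es = false then G ω else 0),
      ← sum_flipEdge es (fun ω => if (flipEdge er ω) er = false ∧ (flipEdge er ω) es = false
        then G (flipEdge er ω) else 0)]
    refine Finset.sum_congr rfl fun ω _ => ?_
    simp only [flipEdge_apply, Function.update_of_ne hne, Function.update_of_ne hne.symm,
      Function.update_self]
    cases h1 : ω er <;> cases h2 : ω es <;> simp [Function.update_comm hne]
  rw [gammaSum_eq_sum_gTerm, ← hG, hsplit, hYW, hWY, hWW, ← Finset.sum_add_distrib,
    ← Finset.sum_add_distrib, ← Finset.sum_add_distrib]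
  refine Finset.sum_congr rfl fun ω _ => ?_
  split_ifs <;> ring

omit [Fintype V] [DecidableEq V] in
/-- **`gammaSum = 2 · dzeroSignSumHP endsT {both T-edges Y}`.** -/
theorem gammaSum_eq_two_dzeroP (her : ends er = s(d, r)) (hes : ends es = s(d, s))
    (hne : er ≠ es) :
    gammaSum ends p q r s d = 2 * dzeroSignSumHP (endsT ends d er es) p q r s
      ({r, s, d} : Set V) (fun ω => ω er = true ∧ ω es = true) := by
  rw [gammaSum_eq_four hne, dzeroSignSumHP, Finset.mul_sum]
  refine Finset.sum_congr rfl fun ω _ => ?_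
  by_cases hYY : ω er = true ∧ ω es = true
  · rw [if_pos hYY, four_gTerms_eq her hes hne hYY.1 hYY.2]
    by_cases hL : sepH (endsT ends d er es) p q ({r, s, d} : Set V) ω ∧
        DZeroH (endsT ends d er es) ({r, s, d} : Set V) ω
    · rw [if_pos hL, if_pos ⟨hL.1, hL.2, hYY⟩]
    · rw [if_neg hL, if_neg (fun h => hL ⟨h.1, h.2.1⟩)]
  · rw [if_neg hYY, if_neg (fun h => hYY h.2.2), mul_zero]

/-- **The doubly-reached sum is non-positive** on every finite multigraph with edges
`er = d–r ≠ es = d–s`. -/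
theorem gammaSum_nonpos (her : ends er = s(d, r)) (hes : ends es = s(d, s)) (hne : er ≠ es) :
    gammaSum ends p q r s d ≤ 0 := by
  rw [gammaSum_eq_two_dzeroP her hes hne]
  have := dzeroP_endsT_nonpos (ends := ends) (p := p) (q := q) (r := r) (s := s) (d := d) er es
  linarith

end Reindex

end NoPocket

end Summit.Ventures.PercRepro2
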